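import Literature.NumberTheory.IwasawaTheory.ClassGroupPRankLeOfRelation
import HarnessLib

/-!
# THE RELATION DOOR, COINVARIANT FORM: `[Cl(K_n) : Cl(K_n)^p · ⟨σc·c⁻¹⟩] ≤ p` (instead of `p² ∤ #Cl(K_n)^{Gal}`), ONE relation `∏ σ^i(c)^{f_i} = 1` on a class
# `c ∉ Cl^{σ−1}·Cl^p` with `∑ f_i X^i = (X−1)^d·u + p·g`, `p ∤ u(1)` ⟹ `rank_p Cl(K_n) ≤ d`; with Fukuda index `0` and `d ≤ p^n − 2`: `μ = 0`, `λ ≤ d`, all ranks `≤ d`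

Topic `NumberTheory/IwasawaTheory` (namespace = path; group-theoretic brick in `Literature.NumberTheory.IwasawaTheory.FukudaRelation`).  THEOREMS ONLY
(no definition, no named fact, no instance, no `sorry`); unconditional.  Written by the prover seat `bsd-line-att-p3` g49 (cell `bsd-f1-sign2`, WIDTH-5 attach on
route `AlignedTransportAtTwo`, crux C2 stmt-BirchSwinnertonDyer-22298; `--supports`, closes nothing).  Sequel of att-p3 g48's `ClassGroupPRankLeOfRelation.lean`
(the RELATION DOOR with the CHEVALLEY hypothesis `p² ∤ #Cl(K_n)^{Gal(K_n/K)}`): the relation lemma (`FukudaRelationAlgebra`) only needs the index of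
`𝔪M = (φ−1)M + pM` to be `≤ p`, i.e. the `Gal`-COINVARIANTS of `Cl(K_n)/p` to be cyclic — a hypothesis WEAKER than Chevalley's (`#M/(φ−1)M = #M^φ`), and the right one
when the group of ambiguous classes is large but the coinvariant quotient is still cyclic.  WHY IT MATTERS (cell bsd-f1-sign2, crux C2, complex cubic `K = ℚ(β)` with
`2 ∤ h_K` and `2 = 𝔭₁𝔭₂`): over such a base the Iwasawa module `X = Λ/J` is CYCLIC for EVERY `2`-adic unit depth `t` (`Y₀ = X`, two ramified primes ⟹ `X/TX` cyclic,
[Washington1997, §13.3 Lemma 13.15]), so `A_n/𝔪A_n` is one-dimensional at every layer — whereas Chevalley's `#Cl(K_n)^G = 2^{t−2}·(odd)` is `≥ 4` as soon as `t ≥ 4`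
(the cell's converse quadrant `N = 1187, 4307, 13971, 14539`, where g48's door cannot fire).  The coinvariant index `[Cl(K_n) : Cl^2·⟨σc·c⁻¹⟩]` is the currency of the
tree's door L12 (`ClassGroupPRankCoinvariantCriterion`, `NumberFields/CoinvariantGenusBound`) and of `UnramifiedElementaryCoinvariantModP` (equivariant Artin): by genus
theory it is `≤ p` whenever `p ∤ h_K`, at most two primes ramify and one of them totally (the genus field of `K_n/K` is `K_n·F`, `Gal = I₁·I₂`, `Gal(genus/K_n) ≅ I₂/(I₁ ∩ I₂)`
cyclic) — that input is DISPLAYED here, not proved.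

* ★★ `FukudaRelation.natCard_pow_eq_one_le_pow_of_relation_of_index_le` — `G` finite commutative, `α` with `α^{p^t} = 1`, **`[G : G^p·⟨α(b)·b⁻¹⟩] ≤ p`**, `c` not of
  the form `α(b)·b⁻¹·e^p`, a relation `∏ (α^i c)^{f_i} = 1` with `∑ f_i X^i = (X−1)^d u + p g`, `p ∤ u(1)` ⟹ `#{g : g^p = 1} ≤ p^d`.  (On `P = G[p^∞]`: the natural map
  `P/((φ−1)P + pP) → G/(G^p·⟨α(b)b⁻¹⟩)` is injective — project a representation `e^p·α(b)b⁻¹` with an exponent `m ≡ 1 (mod p)`, `m ≡ 0 (mod #G/#P)` — so the index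
  of `𝔪P` is `≤ p`; then g48's proof verbatim.)
* ★★★ `classGroupPRank_le_of_relation_of_index_le` — THE RELATION DOOR (one layer), coinvariant form: `rank_p Cl(K_n) ≤ d`.
* ★★★ `classicalMuVanishes_and_classicalLambda_le_of_relation_of_index_le` — Fukuda index `0`, `d + 2 ≤ p^n` ⟹ `rank_p Cl(K_m) ≤ d ∀ m`, `μ = 0`, `λ ≤ d` (door L10).

HONEST SCOPE: classical (Washington §13.3 / Lang Ch. 13 §4 at finite level); nothing specific to any summit; no certificate for any field is asserted; the genus-theoretic
input is displayed; BSD is not advanced by this file.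

## References

* L. C. Washington, *Introduction to Cyclotomic Fields*, 2nd ed. (1997), §13.3 Lemmas 13.15, 13.18, Prop. 13.22–13.23. [Washington1997]
* T. Fukuda, *Remarks on `ℤ_p`-extensions of number fields*, Proc. Japan Acad. 70 A (1994), Thm. 1, p. 264. [Fukuda1994]
* S. Lang, *Cyclotomic Fields I and II*, GTM 121 (1990), Ch. 13 §4 Lemma 4.1. [Lang1990]
* G. Gras, *Class Field Theory* (2003), IV.4 (genus theory). [Gras2003]
-/

set_option autoImplicit false

noncomputable section

open Polynomial Finset

/-! ## §1 The door for a finite commutative group with an automorphism, coinvariant form -/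

namespace Literature.NumberTheory.IwasawaTheory.FukudaRelation

section Group

variable {G : Type*} [CommGroup G] [Finite G] {p : ℕ} [hp : Fact p.Prime]

/-- An exponent `m ≡ 1 (mod p)` projecting `G` onto its `p`-primary component: `g^m ∈ G[p^∞]` for all `g`, `g^m = g` on `G[p^∞]`, `m = 1 + p·r`
(`#G = p^s·u`, `m = u·v` with `u·v ≡ 1 (mod p^{s+1})`). [folklore] -/
private theorem exists_pow_primary_projection :
    ∃ m r : ℕ, m = 1 + p * r ∧ (∀ g : G, g ^ m ∈ CommGroup.primaryComponent G p) ∧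
      (∀ g : G, g ∈ CommGroup.primaryComponent G p → g ^ m = g) := by
  classical
  haveI : Fintype G := Fintype.ofFinite G
  set h := Fintype.card G with hh
  have h0 : h ≠ 0 := Fintype.card_ne_zero
  set s := h.factorization p with hs
  set u := h / p ^ s with hu
  have hpu : Nat.Coprime u (p ^ (s + 1)) := (Nat.coprime_ordCompl hp.out h0).symm.pow_right (s + 1)
  have hhu : p ^ s * u = h := Nat.ordProj_mul_ordCompl_eq_self h p
  have hlt : 1 < p ^ (s + 1) := Nat.one_lt_pow (by omega) hp.out.one_lt
  obtain ⟨v, -, hv⟩ := Nat.exists_mul_mod_eq_one_of_coprime hpu hlt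
  set q := u * v / p ^ (s + 1) with hq
  have huv : u * v = p ^ (s + 1) * q + 1 := by
    have := Nat.div_add_mod (u * v) (p ^ (s + 1)); rw [hv] at this; exact this.symm
  refine ⟨u * v, p ^ s * q, by rw [huv]; ring, fun g => ?_, fun g hg => ?_⟩
  · refine (CommGroup.mem_primaryComponent).mpr ⟨s, ?_⟩
    rw [← pow_mul, mul_comm (u * v), ← mul_assoc, hhu, pow_mul, hh, pow_card_eq_one, one_pow]
  · obtain ⟨k, hk⟩ := (CommGroup.mem_primaryComponent).mp hg
    -- the order of `g` divides `p^k` and `#G = p^s u`, hence `p^s`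
    have hgs : g ^ p ^ s = 1 := by
      have h1 : orderOf g ∣ p ^ k := orderOf_dvd_of_pow_eq_one hk
      have h2 : orderOf g ∣ p ^ s * u := by rw [hhu, hh, ← Nat.card_eq_fintype_card]; exact orderOf_dvd_natCard g
      obtain ⟨j, -, hj⟩ := (Nat.dvd_prime_pow hp.out).mp h1
      have h3 : p ^ j ∣ p ^ s * u := hj ▸ h2
      have h4 : p ^ j ∣ p ^ s := by
        have hcop : Nat.Coprime (p ^ j) u := (Nat.coprime_ordCompl hp.out h0).pow_left j
        exact hcop.dvd_of_dvd_mul_right h3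
      exact orderOf_dvd_iff_pow_eq_one.mp (hj ▸ h4)
    rw [huv, pow_succ, pow_add, pow_one, mul_assoc, pow_mul, hgs, one_pow, one_mul]

omit hp in
/-- `#(M/f(M)) = #ker f` for an endomorphism `f` of a finite abelian group (`M/ker f ≅ f(M)`). [folklore] -/
private theorem card_quotient_range_eq_card_ker₀ {M : Type*} [AddCommGroup M] [Finite M] (f : Module.End ℤ M) :
    Nat.card (M ⧸ LinearMap.range f) = Nat.card (LinearMap.ker f) := by
  have h1 : Nat.card (LinearMap.ker f) * Nat.card (LinearMap.range f) = Nat.card M := by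
    rw [← Nat.card_congr (LinearMap.quotKerEquivRange f).toEquiv]
    exact (Submodule.card_eq_card_quotient_mul_card (LinearMap.ker f)).symm
  have h2 : Nat.card (LinearMap.range f) * Nat.card (M ⧸ LinearMap.range f) = Nat.card M :=
    (Submodule.card_eq_card_quotient_mul_card (LinearMap.range f)).symm
  have hpos : 0 < Nat.card (LinearMap.range f) := Nat.card_pos
  apply Nat.eq_of_mul_eq_mul_left hpos
  rw [h2, ← h1, mul_comm]

omit [Finite G] hp in
/-- Iterates of an automorphism commute with powers. [folklore] -/
private theorem iterate_map_pow' (α : G ≃* G) (i : ℕ) (g : G) (m : ℕ) : (⇑α)^[i] (g ^ m) = ((⇑α)^[i] g) ^ m := by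
  induction i with
  | zero => rfl
  | succ i ih => rw [Function.iterate_succ_apply', Function.iterate_succ_apply', ih, map_pow]

omit [Finite G] hp in
/-- Iterates of an automorphism commute with integer powers. [folklore] -/
private theorem iterate_map_zpow' (α : G ≃* G) (i : ℕ) (g : G) (m : ℤ) : (⇑α)^[i] (g ^ m) = ((⇑α)^[i] g) ^ m := by
  induction i with
  | zero => rfl
  | succ i ih => rw [Function.iterate_succ_apply', Function.iterate_succ_apply', ih, map_zpow]

omit [Finite G] hp in
/-- Iterates of an automorphism are multiplicative. [folklore] -/
private theorem iterate_map_mul' (α : G ≃* G) (i : ℕ) (g g' : G) : (⇑α)^[i] (g * g') = (⇑α)^[i] g * (⇑α)^[i] g' := by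
  induction i with
  | zero => rfl
  | succ i ih => rw [Function.iterate_succ_apply', Function.iterate_succ_apply', Function.iterate_succ_apply', ih, map_mul]

omit [Finite G] hp in
/-- Iterates of an automorphism send `1` to `1`. [folklore] -/
private theorem iterate_map_one' (α : G ≃* G) (i : ℕ) : (⇑α)^[i] (1 : G) = 1 := by
  induction i with
  | zero => rfl
  | succ i ih => rw [Function.iterate_succ_apply', ih, map_one]

/-- ★★ **THE RELATION DOOR for a finite commutative group, COINVARIANT FORM.**  `α` an automorphism of `G` with `α^{p^t} = 1`,
**`[G : G^p·⟨α(b)·b⁻¹ : b⟩] ≤ p`** (the `α`-coinvariants of `G/p` are cyclic), a class `c` **not of the form `α(b)·b⁻¹·e^p`**, and a relation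
**`∏_{i<N} (α^i c)^{f_i} = 1`** whose coefficient polynomial is `∑ f_i X^i = (X−1)^d·u + p·g` with `p ∤ u(1)`.  THEN **`#{g : g^p = 1} ≤ p^d`**.  On `P = G[p^∞]`
with `φ = α|_P`: `P/((φ−1)P + pP)` injects into `G/(G^p·⟨α(b)b⁻¹⟩)` (projection with `m ≡ 1 (mod p)`), so `#P/𝔪P ≤ p`; the projection `c^m` of `c` lies outside `𝔪P`
and satisfies the same relation, and the relation lemma gives `#P/pP ≤ p^d`.
[cite: Washington1997, §13.3 Lemmas 13.15, 13.18 and Prop. 13.22–13.23] [cite: Lang1990, Ch. 13 §4 Lemma 4.1] -/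
theorem natCard_pow_eq_one_le_pow_of_relation_of_index_le (α : G ≃* G) {t : ℕ} (hα : ∀ g, (⇑α)^[p ^ t] g = g)
    (hcoinv : ((powMonoidHom p : G →* G).range ⊔ Subgroup.closure {x | ∃ x' : G, x = α x' * x'⁻¹}).index ≤ p)
    {c : G} (hc : ¬ ∃ b e : G, c = α b / b * e ^ p)
    {N d : ℕ} {f : ℕ → ℤ} {u g : ℤ[X]} (hu : ¬ (p : ℤ) ∣ u.eval 1)
    (hF : (∑ i ∈ range N, C (f i) * X ^ i : ℤ[X]) = (X - 1) ^ d * u + C (p : ℤ) * g)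
    (hrel : ∏ i ∈ range N, ((⇑α)^[i] c) ^ (f i) = 1) :
    Nat.card {g : G // g ^ p = 1} ≤ p ^ d := by
  classical
  set P : Subgroup G := CommGroup.primaryComponent G p with hP
  have hPmem : ∀ {g : G}, g ∈ P ↔ ∃ k : ℕ, g ^ p ^ k = 1 := fun {g} => CommGroup.mem_primaryComponent
  -- `α` restricted to `P`
  have hαP : ∀ g : P, α (g : G) ∈ P := fun g => by
    obtain ⟨k, hk⟩ := hPmem.mp g.2
    exact hPmem.mpr ⟨k, by rw [← map_pow, hk, map_one]⟩
  let αP : P →* P :=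
    { toFun := fun g => ⟨α g, hαP g⟩
      map_one' := Subtype.ext (by simp)
      map_mul' := fun a b => Subtype.ext (by simp) }
  have hαP_apply : ∀ g : P, ((αP g : P) : G) = α g := fun _ => rfl
  -- additive module `M = P`, `φ = α|_P`
  let φ : Module.End ℤ (Additive P) := (MonoidHom.toAdditive αP).toIntLinearMap
  have hφ_apply : ∀ x : Additive P, φ x = Additive.ofMul (αP (Additive.toMul x)) := fun _ => rfl
  -- iterates: `(φ^i x : G) = α^i (x : G)`
  have hφi : ∀ (i : ℕ) (x : Additive P), ((Additive.toMul ((φ ^ i) x) : P) : G) = (⇑α)^[i] ((Additive.toMul x : P) : G) := by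
    intro i
    induction i with
    | zero => intro x; rfl
    | succ i ih =>
      intro x
      rw [pow_succ', Module.End.mul_apply, Function.iterate_succ_apply', ← ih x, hφ_apply, toMul_ofMul, hαP_apply]
  have hφt : φ ^ p ^ t = 1 := by
    apply LinearMap.ext
    intro x
    rw [Module.End.one_apply]
    apply Additive.toMul.injective
    apply Subtype.ext
    rw [hφi, hα]
  have hM : ∃ a : ℕ, Nat.card (Additive P) = p ^ a := (CommGroup.primaryComponent.isPGroup (G := G) (p := p)).exists_card_eq
  set π : Module.End ℤ (Additive P) := (p : ℤ) • 1 with hπ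
  have hπ_apply : ∀ x : Additive P, π x = (p : ℤ) • x := fun _ => rfl
  -- (1) the projection exponent `m = 1 + p r` onto `P`
  obtain ⟨m, r, hm, hmem, hid⟩ := exists_pow_primary_projection (G := G) (p := p)
  -- (1') `#(P/((φ−1)P + pP)) ≤ [G : G^p·⟨α(b)·b⁻¹⟩] ≤ p`: the natural map `P/𝔪P → G/(G^p·⟨α(b)·b⁻¹⟩)` is injective (project with `m`)
  set Cco : Subgroup G := (powMonoidHom p : G →* G).range ⊔ Subgroup.closure {x | ∃ x' : G, x = α x' * x'⁻¹} with hCco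
  set Q : Submodule ℤ (Additive P) := (⊤ : Submodule ℤ (Additive P)).map π ⊔ (⊤ : Submodule ℤ (Additive P)).map (φ - 1) with hQdef
  -- the difference map `δ b = α(b)·b⁻¹` is a homomorphism with range the closure
  let δ : G →* G :=
    { toFun := fun b => α b * b⁻¹
      map_one' := by simp
      map_mul' := fun a b => by rw [map_mul, mul_inv]; simp only [mul_assoc, mul_left_comm, mul_comm] }
  have hδ_apply : ∀ b, δ b = α b * b⁻¹ := fun _ => rfl
  have hclos : Subgroup.closure {x | ∃ x' : G, x = α x' * x'⁻¹} = δ.range := by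
    apply le_antisymm
    · rw [Subgroup.closure_le]
      rintro x ⟨x', rfl⟩
      exact ⟨x', rfl⟩
    · rintro x ⟨x', rfl⟩
      exact Subgroup.subset_closure ⟨x', rfl⟩
  -- the map `ψ : P → G/Cco`
  let ψ : Additive P →ₗ[ℤ] Additive (G ⧸ Cco) :=
    ((MonoidHom.toAdditive ((QuotientGroup.mk' Cco).comp P.subtype))).toIntLinearMap
  have hψ_apply : ∀ x : Additive P, ψ x = Additive.ofMul (QuotientGroup.mk (s := Cco) ((Additive.toMul x : P) : G)) := fun _ => rfl
  have hψ_ker : ∀ x : Additive P, x ∈ LinearMap.ker ψ ↔ ((Additive.toMul x : P) : G) ∈ Cco := by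
    intro x
    rw [LinearMap.mem_ker, hψ_apply, ← ofMul_one, Additive.ofMul.injective.eq_iff, QuotientGroup.eq_one_iff]
  have hQker : Q = LinearMap.ker ψ := by
    apply le_antisymm
    · -- `pP` and `(φ−1)P` map into `Cco`
      rw [hQdef, sup_le_iff]
      constructor
      · rintro _ ⟨y, -, rfl⟩
        rw [hψ_ker, hπ_apply, toMul_zsmul, SubgroupClass.coe_zpow, zpow_natCast]
        exact Subgroup.mem_sup_left ⟨((Additive.toMul y : P) : G), rfl⟩
      · rintro _ ⟨y, -, rfl⟩
        rw [hψ_ker, LinearMap.sub_apply, Module.End.one_apply, toMul_sub, Subgroup.coe_div, hφ_apply, toMul_ofMul, hαP_apply,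
          div_eq_mul_inv]
        exact Subgroup.mem_sup_right (Subgroup.subset_closure ⟨_, rfl⟩)
    · -- an element of `P ∩ Cco` is `e^p · α(b)·b⁻¹`; project with `m`
      intro x hx
      rw [hψ_ker, hCco, hclos] at hx
      obtain ⟨y, ⟨e, rfl⟩, z, ⟨b, rfl⟩, hyz⟩ := Subgroup.mem_sup.mp hx
      rw [powMonoidHom_apply, hδ_apply] at hyz
      -- `x = x^m = (e^m)^p · α(b^m)·(b^m)⁻¹`
      have hxm : ((Additive.toMul x : P) : G) = (e ^ m) ^ p * (α (b ^ m) * (b ^ m)⁻¹) := by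
        rw [← hid _ (Additive.toMul x).2, ← hyz, mul_pow, ← pow_mul, mul_comm p m, pow_mul, mul_pow, map_pow, inv_pow]
      rw [hQdef]
      refine Submodule.mem_sup.mpr ⟨π (Additive.ofMul ⟨e ^ m, hmem e⟩), Submodule.mem_map_of_mem trivial,
        (φ - 1) (Additive.ofMul ⟨b ^ m, hmem b⟩), Submodule.mem_map_of_mem trivial, ?_⟩
      apply Additive.toMul.injective
      apply Subtype.ext
      rw [toMul_add, Subgroup.coe_mul, hπ_apply, toMul_zsmul, SubgroupClass.coe_zpow, zpow_natCast, LinearMap.sub_apply,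
        Module.End.one_apply, toMul_sub, Subgroup.coe_div, hφ_apply]
      simp only [toMul_ofMul, hαP_apply]
      rw [hxm, div_eq_mul_inv]
  have hQ : Nat.card (Additive P ⧸ ((⊤ : Submodule ℤ (Additive P)).map π ⊔ (⊤ : Submodule ℤ (Additive P)).map (φ - 1))) ≤ p := by
    rw [← hQdef, hQker, Nat.card_congr (LinearMap.quotKerEquivRange ψ).toEquiv]
    refine le_trans ?_ hcoinv
    rw [Subgroup.index]
    have : Nat.card (Additive (G ⧸ Cco)) = Nat.card (G ⧸ Cco) := Nat.card_congr Additive.toMul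
    rw [← this]
    exact Nat.card_le_card_of_injective _ Subtype.val_injective
  -- (2) the projection `x₀ = c^m` of `c` to `P`, outside `𝔪P`
  set x₀ : Additive P := Additive.ofMul ⟨c ^ m, hmem c⟩ with hx₀def
  have hx₀G : ((Additive.toMul x₀ : P) : G) = c ^ m := rfl
  have hx₀ : x₀ ∉ (⊤ : Submodule ℤ (Additive P)).map π ⊔ (⊤ : Submodule ℤ (Additive P)).map (φ - 1) := by
    intro hx
    obtain ⟨y, hy, z, hz, hyz⟩ := Submodule.mem_sup.mp hx
    obtain ⟨y', -, rfl⟩ := Submodule.mem_map.mp hy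
    obtain ⟨z', -, rfl⟩ := Submodule.mem_map.mp hz
    apply hc
    -- `c^m = y'^p · α(z') · z'⁻¹` in `G`
    have hG : c ^ m = ((Additive.toMul y' : P) : G) ^ (p : ℤ) * (α ((Additive.toMul z' : P) : G) / ((Additive.toMul z' : P) : G)) := by
      have h : ((Additive.toMul (π y' + (φ - 1) z') : P) : G) = ((Additive.toMul x₀ : P) : G) := by rw [hyz]
      rw [hx₀G] at h
      rw [← h, toMul_add, Subgroup.coe_mul, hπ_apply, toMul_zsmul, SubgroupClass.coe_zpow, LinearMap.sub_apply,
        Module.End.one_apply, toMul_sub, Subgroup.coe_div, hφ_apply, toMul_ofMul, hαP_apply]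
    -- `c = c^m · (c^r)^{-p}`
    refine ⟨((Additive.toMul z' : P) : G), ((Additive.toMul y' : P) : G) * (c ^ r)⁻¹, ?_⟩
    have hcm : c = c ^ m * ((c ^ r)⁻¹) ^ p := by
      rw [hm, mul_comm p r, pow_add, pow_one, pow_mul, inv_pow, mul_inv_cancel_right]
    calc c = c ^ m * ((c ^ r)⁻¹) ^ p := hcm
      _ = ((Additive.toMul y' : P) : G) ^ (p : ℤ) * (α ((Additive.toMul z' : P) : G) / ((Additive.toMul z' : P) : G)) *
            ((c ^ r)⁻¹) ^ p := by rw [hG]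
      _ = α ((Additive.toMul z' : P) : G) / ((Additive.toMul z' : P) : G) * (((Additive.toMul y' : P) : G) * (c ^ r)⁻¹) ^ p := by
          rw [mul_pow, zpow_natCast]; ac_rfl
  -- (3) the relation for `x₀`
  have hrel' : ∑ i ∈ range N, f i • (φ ^ i) x₀ = 0 := by
    apply Additive.toMul.injective
    apply Subtype.ext
    rw [toMul_sum, toMul_zero, SubmonoidClass.coe_finsetProd, Subgroup.coe_one]
    have hterm : ∀ i ∈ range N, ((Additive.toMul (f i • (φ ^ i) x₀) : P) : G) = (((⇑α)^[i] c) ^ (f i)) ^ m := by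
      intro i _
      rw [toMul_zsmul, SubgroupClass.coe_zpow, hφi, hx₀G, iterate_map_pow', ← zpow_natCast, ← zpow_mul, ← zpow_natCast,
        ← zpow_mul, mul_comm]
    rw [Finset.prod_congr rfl hterm, Finset.prod_pow, hrel, one_pow]
  -- (4) the relation lemma: `#(P/pP) ≤ p^d`
  have h3 := card_quotient_smul_le_pow_of_sum_smul_pow_apply_eq_zero hM φ hφt hQ hx₀ hu hF hrel'
  -- `{g : g^p = 1} ≃ ker π`, `#ker π = #(P/pP)`
  have hkerπ : Nat.card (LinearMap.ker π) = Nat.card (Additive P ⧸ (⊤ : Submodule ℤ (Additive P)).map π) := by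
    rw [Submodule.map_top, card_quotient_range_eq_card_ker₀]
  have hsq : ∀ {g : G}, g ^ p = 1 → g ∈ P := fun {g} hg => hPmem.mpr ⟨1, by rw [pow_one]; exact hg⟩
  have hiff2 : ∀ x : Additive P, x ∈ LinearMap.ker π ↔ ((Additive.toMul x : P) : G) ^ p = 1 := by
    intro x
    rw [LinearMap.mem_ker, hπ_apply, show ((p : ℤ) • x = 0 ↔ (p : ℕ) • x = 0) from by rw [← natCast_zsmul]]
    constructor
    · intro h
      have h' : (Additive.toMul x : P) ^ p = 1 := by
        have := congrArg Additive.toMul h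
        rwa [toMul_nsmul, toMul_zero] at this
      have := congrArg (fun z : P => (z : G)) h'
      simpa using this
    · intro h
      have h' : (Additive.toMul x : P) ^ p = 1 := Subtype.ext (by simpa using h)
      have := congrArg Additive.ofMul h'
      rwa [ofMul_pow, ofMul_toMul, ofMul_one] at this
  let e2 : {g : G // g ^ p = 1} ≃ LinearMap.ker π :=
    { toFun := fun g => ⟨Additive.ofMul ⟨(g : G), hsq g.2⟩, (hiff2 _).mpr (by simpa using g.2)⟩
      invFun := fun x => ⟨((Additive.toMul (x : Additive P) : P) : G), (hiff2 x.1).mp x.2⟩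
      left_inv := fun g => Subtype.ext rfl
      right_inv := fun x => by apply Subtype.ext; apply Additive.toMul.injective; exact Subtype.ext rfl }
  rw [Nat.card_congr e2, hkerπ]
  exact h3

end Group

end Literature.NumberTheory.IwasawaTheory.FukudaRelation

/-! ## §2 The door in a `ℤ_p`-tower, coinvariant form -/

namespace Literature.NumberTheory.IwasawaTheory

open scoped NumberField
open NumberField Field Literature.NumberTheory.EllipticCurves Literature.NumberTheory.NumberFields
  Literature.NumberTheory.GaloisRepresentations

section Door

variable {K : Type} [Field K] [NumberField K] {p : ℕ} [hp : Fact p.Prime]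

/-- ★★★ **THE RELATION DOOR (one layer), COINVARIANT FORM.**  `κ` a `ℤ_p`-extension of the number field `K`, `n` a layer, `σ ∈ Gal(K_n/K)` (a generator, in every application);
**`[Cl(K_n) : Cl(K_n)^p·⟨σx·x⁻¹⟩] ≤ p`** (the `Gal`-coinvariants of `Cl(K_n)/p` are cyclic — genus theory: automatic when `p ∤ h_K` and at most two primes ramify, one
totally; displayed); a class `c` **not of the form `σ(b)·b⁻¹·e^p`**; and **ONE RELATION `∏_{i<N} σ^i(c)^{f_i} = 1`** with `∑ f_i X^i = (X−1)^d·u + p·g`, `p ∤ u(1)`.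
THEN **`rank_p Cl(K_n) ≤ d`**. [cite: Washington1997, §13.3 Lemmas 13.15, 13.18 and Prop. 13.22–13.23] [cite: NeukirchANT1999, Ch. I §9 (9.6)]
[cite: Lang1990, Ch. 13 §4 Lemma 4.1] [cite: Gras2003, IV.4] -/
theorem classGroupPRank_le_of_relation_of_index_le (κ : ZpExtension K p) (n : ℕ) (σ : (κ.layer n) ≃ₐ[K] (κ.layer n))
    (hcoinv : ((powMonoidHom p : ClassGroup (𝓞 (κ.layer n)) →* ClassGroup (𝓞 (κ.layer n))).range ⊔
        Subgroup.closure {x | ∃ x' : ClassGroup (𝓞 (κ.layer n)), x = ClassGroup.mulEquiv (AmbiguousClass.intAut σ) x' * x'⁻¹}).index ≤ p)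
    {c : ClassGroup (𝓞 (κ.layer n))}
    (hc : ¬ ∃ b e : ClassGroup (𝓞 (κ.layer n)), c = ClassGroup.mulEquiv (AmbiguousClass.intAut σ) b / b * e ^ p)
    {N d : ℕ} {f : ℕ → ℤ} {u g : ℤ[X]} (hu : ¬ (p : ℤ) ∣ u.eval 1)
    (hF : (∑ i ∈ range N, C (f i) * X ^ i : ℤ[X]) = (X - 1) ^ d * u + C (p : ℤ) * g)
    (hrel : ∏ i ∈ range N, (ClassGroup.mulEquiv (AmbiguousClass.intAut (σ ^ i)) c) ^ (f i) = 1) :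
    classGroupPRank κ n ≤ d := by
  classical
  haveI : FiniteDimensional K (κ.layer n) := κ.finiteDimensional_layer_holds n
  haveI : NumberField (κ.layer n) := NumberField.of_module_finite K _
  haveI : IsGalois K (κ.layer n) := κ.isGalois_layer_holds n
  let α : ClassGroup (𝓞 (κ.layer n)) ≃* ClassGroup (𝓞 (κ.layer n)) := ClassGroup.mulEquiv (AmbiguousClass.intAut σ)
  have hα : ∀ x, α x = ClassGroup.mulEquiv (AmbiguousClass.intAut σ) x := fun _ => rfl
  -- iterates of `α` are the powers of `σ`
  have hpow : ∀ (k : ℕ) (x : ClassGroup (𝓞 (κ.layer n))), (⇑α)^[k] x = ClassGroup.mulEquiv (AmbiguousClass.intAut (σ ^ k)) x := by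
    intro k
    induction k with
    | zero => intro x; rw [Function.iterate_zero, id, pow_zero, AmbiguousClass.mulEquiv_intAut_one, MulEquiv.refl_apply]
    | succ k ih =>
      intro x
      rw [Function.iterate_succ_apply', ih, pow_succ', AmbiguousClass.mulEquiv_intAut_mul, MulEquiv.trans_apply]
  -- `σ^{p^n} = 1`
  have hσord : σ ^ p ^ n = 1 := by
    have h := pow_card_eq_one' (G := (κ.layer n) ≃ₐ[K] (κ.layer n)) (x := σ)
    rwa [IsGalois.card_aut_eq_finrank, κ.finrank_layer_holds n] at h
  have hαt : ∀ x, (⇑α)^[p ^ n] x = x := fun x => by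
    rw [hpow, hσord, AmbiguousClass.mulEquiv_intAut_one, MulEquiv.refl_apply]
  have hrel' : ∏ i ∈ range N, ((⇑α)^[i] c) ^ (f i) = 1 := by
    rw [← hrel]; exact Finset.prod_congr rfl fun i _ => by rw [hpow]
  have h := FukudaRelation.natCard_pow_eq_one_le_pow_of_relation_of_index_le α hαt hcoinv hc hu hF hrel'
  rw [natCard_torsion_classGroup_layer_eq κ n] at h
  exact (Nat.pow_le_pow_iff_right hp.out.one_lt).mp h

/-- ★★★ **THE RELATION DOOR, COINVARIANT FORM (every layer, `μ = 0`, `λ ≤ d`).**  `κ` a `ℤ_p`-extension with Fukuda index `0` (`TotallyRamifiedFrom κ 0`), a layer `n`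
with **`d + 2 ≤ p^n`**, and the data of `classGroupPRank_le_of_relation_of_index_le` at layer `n` (coinvariant index `≤ p`, `c ∉ Cl^{σ−1}·Cl^p`, one relation of order `d`
at `σ = 1` mod `p`).  THEN **`rank_p Cl(K_m) ≤ d` for every `m`, `μ(κ) = 0` and `λ(κ) ≤ d`** (door L10 at layer `n`).
[cite: Washington1997, §13.3 Prop. 13.22–13.23] [cite: Fukuda1994, Thm. 1, p. 264] -/
theorem classicalMuVanishes_and_classicalLambda_le_of_relation_of_index_le (κ : ZpExtension K p) (hκ : TotallyRamifiedFrom κ 0) {n : ℕ}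
    (σ : (κ.layer n) ≃ₐ[K] (κ.layer n))
    (hcoinv : ((powMonoidHom p : ClassGroup (𝓞 (κ.layer n)) →* ClassGroup (𝓞 (κ.layer n))).range ⊔
        Subgroup.closure {x | ∃ x' : ClassGroup (𝓞 (κ.layer n)), x = ClassGroup.mulEquiv (AmbiguousClass.intAut σ) x' * x'⁻¹}).index ≤ p)
    {c : ClassGroup (𝓞 (κ.layer n))}
    (hc : ¬ ∃ b e : ClassGroup (𝓞 (κ.layer n)), c = ClassGroup.mulEquiv (AmbiguousClass.intAut σ) b / b * e ^ p)
    {N d : ℕ} (hd : d + 2 ≤ p ^ n) {f : ℕ → ℤ} {u g : ℤ[X]} (hu : ¬ (p : ℤ) ∣ u.eval 1)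
    (hF : (∑ i ∈ range N, C (f i) * X ^ i : ℤ[X]) = (X - 1) ^ d * u + C (p : ℤ) * g)
    (hrel : ∏ i ∈ range N, (ClassGroup.mulEquiv (AmbiguousClass.intAut (σ ^ i)) c) ^ (f i) = 1) :
    (∀ m, classGroupPRank κ m ≤ d) ∧ ClassicalMuVanishes κ ∧ classicalLambda κ ≤ d := by
  have hn := classGroupPRank_le_of_relation_of_index_le κ n σ hcoinv hc hu hF hrel
  have hsmall : classGroupPRank κ (0 + n) < p ^ n - 1 := by rw [Nat.zero_add]; omega
  have hall : ∀ m, classGroupPRank κ m ≤ d := fun m => by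
    have h := classGroupPRank_le_of_lt_pow_sub_one κ hκ le_rfl hsmall m
    rw [Nat.zero_add, Nat.zero_add] at h
    exact h.trans hn
  exact ⟨hall, classicalLambda_le_of_forall_classGroupPRank_le κ hκ (n := 0) le_rfl (B := d) fun m _ => hall m⟩

/-- **Chevalley ⟹ coinvariant**: `p² ∤ #{x : αx = x}` ⟹ `[G : G^p·⟨α(b)b⁻¹⟩] ≤ p` for a finite commutative `G` (`#G/⟨α(b)b⁻¹⟩ = #{x : αx = x}` and the quotient by
`G^p·⟨α(b)b⁻¹⟩` is a `p`-elementary quotient of it), so the coinvariant form contains g48's door.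
[cite: Washington1997, §13.3 Lemma 13.18] [cite: Lang1990, Ch. 13 §4 Lemma 4.1] -/
theorem index_pow_sup_closure_le_of_not_sq_dvd_card_fixed {G : Type*} [CommGroup G] [Finite G] (α : G ≃* G)
    (hfix : ¬ p ^ 2 ∣ Nat.card {g : G // α g = g}) :
    ((powMonoidHom p : G →* G).range ⊔ Subgroup.closure {x | ∃ x' : G, x = α x' * x'⁻¹}).index ≤ p := by
  classical
  -- `δ b = α(b)·b⁻¹`, `#range δ · #ker δ = #G`, `ker δ = Fix`
  let δ : G →* G :=
    { toFun := fun b => α b * b⁻¹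
      map_one' := by simp
      map_mul' := fun a b => by rw [map_mul, mul_inv]; simp only [mul_assoc, mul_left_comm, mul_comm] }
  have hclos : Subgroup.closure {x | ∃ x' : G, x = α x' * x'⁻¹} = δ.range := by
    apply le_antisymm
    · rw [Subgroup.closure_le]
      rintro x ⟨x', rfl⟩
      exact ⟨x', rfl⟩
    · rintro x ⟨x', rfl⟩
      exact Subgroup.subset_closure ⟨x', rfl⟩
  have hker : Nat.card δ.ker = Nat.card {g : G // α g = g} := by
    refine Nat.card_congr (Equiv.subtypeEquivRight fun g => ?_)
    change α g * g⁻¹ = 1 ↔ α g = g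
    rw [mul_inv_eq_one]
  have hidx : δ.range.index = Nat.card {g : G // α g = g} := by
    rw [← hker]
    have h1 := Subgroup.card_mul_index δ.range
    have h2 : Nat.card δ.range * Nat.card δ.ker = Nat.card G := by
      rw [← Nat.card_congr (QuotientGroup.quotientKerEquivRange δ).toEquiv]
      exact (Subgroup.card_eq_card_quotient_mul_card_subgroup δ.ker).symm
    have hpos : 0 < Nat.card δ.range := Nat.card_pos
    exact Nat.eq_of_mul_eq_mul_left hpos (h1.trans h2.symm)
  -- the index of `C = G^p ⊔ range δ` divides `#Fix` and is `1` or `p`-free-of-squares… : it is a divisor of `[G : range δ]` not divisible by `p²`,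
  -- and `G/C` has exponent `p`, so the index is a power of `p`; hence `≤ p`.
  set C := (powMonoidHom p : G →* G).range ⊔ Subgroup.closure {x | ∃ x' : G, x = α x' * x'⁻¹} with hC
  have hle : δ.range ≤ C := by rw [hC, hclos]; exact le_sup_right
  have hdvd : C.index ∣ Nat.card {g : G // α g = g} := by rw [← hidx]; exact Subgroup.index_dvd_of_le hle
  -- `C.index` is a power of `p`: every element of `G/C` has order dividing `p`
  haveI : C.Normal := inferInstance
  have hexp : ∀ x : G ⧸ C, x ^ p = 1 := by
    intro x
    induction x using QuotientGroup.induction_on with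
    | H g =>
      rw [← QuotientGroup.mk_pow, QuotientGroup.eq_one_iff]
      exact Subgroup.mem_sup_left ⟨g, rfl⟩
  obtain ⟨k, hk⟩ : ∃ k : ℕ, C.index = p ^ k := by
    have hG : IsPGroup p (G ⧸ C) := fun x => ⟨1, by rw [pow_one]; exact hexp x⟩
    obtain ⟨k, hk⟩ := hG.exists_card_eq
    exact ⟨k, by rw [Subgroup.index, hk]⟩
  rw [hk] at hdvd ⊢
  rcases Nat.lt_or_ge k 2 with hk2 | hk2
  · interval_cases k
    · rw [pow_zero]; exact hp.out.one_lt.le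
    · rw [pow_one]
  · exact absurd ((pow_dvd_pow p hk2).trans hdvd) hfix

end Door

end Literature.NumberTheory.IwasawaTheory

end
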